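import Mathlib
import HarnessLib

/-!
# Venture HSemireg — LEMMA P (Walsh–parity lower bound) of the g = 8 family-B census FOR EVERY n: a unit-graph design on E_iⁿ × E_iⁿ
# whose mixed-sign full moments vanish and whose moment m̂(+,…,+) is non-zero has AT LEAST 2^{n−1} letters in its support — the
# Walsh–Hadamard inversion on (ℤ∕2)ⁿ proved by the product formula (no `decide`), with the «only if» half of the equality clause

HONEST FRAMING. Part of the Lean index of the computation cell `pub-hsemireg` (Sunday typer seat p9, § g = 8; family B rows **B20-k** of
`target-g8/CENSUS.md` v1.274 `7744dc4867915f69`, in particular the words «LEMMA P bound 2^(n−1)» (row B20-0, the ladder of minimal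
designs Z_{2^{n−1}}, n = 1, 2, 3, 4) and «LEMMA P, B20-4: minimum 8 at n = 4»). FINITE GAUSSIAN-INTEGER ARITHMETIC ONLY: functions
`m : (ℤ∕4)ⁿ → ℤ` («designs», by their exponent vectors), the 2ⁿ characters `x ↦ i^{ε·x}` (`ε ∈ {±1}ⁿ`), their moments, and a count of
the support. No abelian variety, graph Γ_D, cycle, class or filler is constructed; LEMMA W (the criterion «class-completable ⟺ all mixed
full moments vanish; W-alive ⟺ m̂(1,…,1) ≠ 0») is the DICTIONARY that makes the hypotheses below the census's hypotheses — TEXT OF RECORD,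
not a binder and not proved here; nothing here says that HC ∕ HC_CM ∕ HC_AV holds; no object is certified; no Literature fact is declared.
The sister file `WalshParityN4.lean` (p9 g4) proves the case n = 4 by kernel `decide`; this file proves the statement for every n by
hand and does not import it (the two files use the same vocabulary, with `n` a parameter here and `I ^ k` in place of the table `ipow k`).

TEXTS OF RECORD (quoted, not interpreted). Source: t-20, `target-g8/FAMILY-B-G8-t20.md` v1.25 `987a3ee140325c40`. §1 FRAME: «A
unit-graph DESIGN is m : μ_Kⁿ → ℤ (ℤ_{≥0} = effective), Γ_D = Π_k Γ_{D_k} = graph of the diagonal matrix D; for K = ℚ(i) write D_k =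
i^{x_k}, x ∈ (ℤ/4)ⁿ, and m̂(ε) := Σ_x m(x) i^{ε·x} for ε ∈ {0,±1}ⁿ.» §2.1 LEMMA W (dictionary, NOT proved here): «an effective unit-graph
design extends by effective fillers to a CLASS-EXACT cycle iff m̂(ε) = 0 for every mixed-sign ε ∈ {±1}ⁿ (2ⁿ − 2 conditions; 14 at
n = 4), and the result is W-ALIVE iff m̂(1,…,1) ≠ 0.» §2.2 LEMMA P (typed here for every n): «For ε ∈ {±1}ⁿ, i^{ε·x} =
i^{|x|}·(−1)^{Σ_{k: ε_k = −1} x_k}, so with S_p := Σ_{x ≡ p (mod 2)} m(x) i^{|x|} (p ∈ (ℤ/2)ⁿ) the vector (m̂(ε))_ε is the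
Walsh–Hadamard transform of (S_p)_p. The conditions «m̂ = 0 at mixed ε, m̂(+1ⁿ) = α» invert to S_p = 2^{−n}(α + (−1)^{|p|}ᾱ), i.e. S_p =
Re α/2^{n−1} for |p| even and i·Im α/2^{n−1} for |p| odd. α ≠ 0 ⇒ at least 2^{n−1} parity classes carry support ⇒ every (effective or
signed) class-completable W-alive unit-graph design has ≥ 2^{n−1} graphs, with equality iff the support is one letter-vector in each
class of one parity family with m(x)i^{|x|} constant.» Row B20-0: «LADDER of minimal effective W-alive unit-graph designs Z_{2^{n−1}} …
n = 1,2,3,4 (1/2/4/8 graphs …)»; row B20-3: «LEMMA P bound 2^(n−1)».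

WHAT THIS FILE PROVES (every `n : ℕ`; `Letter n = Fin n → Fin 4` = exponent vectors x, `Sgn n = Fin n → Fin 2` = sign patterns δ with
ε_k = (−1)^{δ_k}, also used for parity classes p; `I = ⟨0, 1⟩ ∈ ℤ[i]`). `chi δ x` = i^{ε(δ)·x} (ε_k x_k taken as x_k or 3x_k);
`wsign δ p` = (−1)^{δ·p}; `wt x` = |x|; `par x` = x mod 2; `moment m δ` = m̂(ε(δ)); `S m p` = S_p. THEOREMS: `chi_eq` (the first
sentence of LEMMA P: i^{ε·x} = i^{|x|}·(−1)^{Σ_{δ_k = 1} x_k}); **`walsh_sum`** (Σ_{δ ∈ (ℤ∕2)ⁿ} (−1)^{Σ_k δ_k q_k} = 2ⁿ if every q_k is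
even and 0 otherwise — the product formula Π_k (1 + (−1)^{q_k})); `walsh_pointwise` (Σ_δ (−1)^{δ·p} i^{ε(δ)·x} = 2ⁿ·[x ≡ p]·i^{|x|});
**`inversion`** (2ⁿ·S_p = Σ_δ (−1)^{δ·p} m̂(δ)); `moment_one_eq_star` (m̂(−,…,−) = conj m̂(+,…,+)); **`S_formula`** ∕ `S_formula_parts`
(n ≥ 1, mixed moments zero ⇒ 2ⁿ·S_p = α + (−1)^{|p|}·ᾱ = 2·Re α on even classes, 2i·Im α on odd classes); `card_parityFamily` (each
parity family of (ℤ∕2)^{k+1} has 2^k classes — bijection with (ℤ∕2)^k by dropping the first coordinate); **`two_pow_le_card_support`**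
= LEMMA P for every n: mixed moments zero ∧ α ≠ 0 ⇒ #{x : m(x) ≠ 0} ≥ 2^{n−1}, for every INTEGER-valued m (effective or signed);
corollaries `moment_zero_eq_zero_of_card_lt` (support < 2^{n−1} and mixed moments 0 ⇒ W-dead), `two_pow_le_card_support_of_re_im`
(Re α ≠ 0 ∧ Im α ≠ 0 ⇒ support ≥ 2ⁿ) and `re_eq_zero_or_im_eq_zero_of_card_eq` (the «only if» half of «equality iff», first part: a
design attaining 2^{n−1} has α real or purely imaginary — one parity family only).

WHAT IS NOT HERE. LEMMA W itself (the e-word expansion and the Walsh cascade), the «if» half of «equality iff» and the minimal designs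
Z_{2^{n−1}} for general n (row B20-0's ladder is t-20 ∣ t-22 ×2 by machine; the n = 4 member Z₈ is `WalshParity.z8_moments`), the
ℚ(ω) point (§2.7), and every member computation of §3.
-/

namespace Summit.Ventures.HSemireg.WalshParityN

open Finset

variable {n : ℕ}

/-- Exponent vectors `x ∈ (ℤ∕4)ⁿ`: the letter of factor `k` is the unit `i^{x_k}` (t-20 §1 «D_k = i^{x_k}, x ∈ (ℤ/4)ⁿ»).
[definition of this file] -/
abbrev Letter (n : ℕ) := Fin n → Fin 4

/-- Sign ∕ parity patterns `δ ∈ (ℤ∕2)ⁿ`: the sign vector is `ε_k = (−1)^{δ_k}`; the same type indexes parity classes `p`.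
[definition of this file] -/
abbrev Sgn (n : ℕ) := Fin n → Fin 2

/-- The Gaussian integer `i = ⟨0, 1⟩`. [definition of this file] -/
def I : GaussianInt := ⟨0, 1⟩

/-- `i² = −1`. -/
theorem I_sq : I ^ 2 = -1 := by decide

/-- `conj i = i³`. -/
theorem star_I : star I = I ^ 3 := by decide

/-- `i⁴ = 1`. -/
theorem I_pow_four : I ^ 4 = 1 := by decide

/-- The exponent of `i` contributed by factor `k`: `ε_k x_k (mod 4)`, i.e. `x_k` if `δ_k = 0` and `3x_k ≡ −x_k` if `δ_k = 1`.
[definition of this file] -/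
def sgnExp (d : Fin 2) (x : Fin 4) : ℕ := if d = 0 then x.val else 3 * x.val

/-- `ε_k x_k ≡ x_k + 2·δ_k x_k`: the twisted exponent is the plain one plus an even correction. -/
theorem sgnExp_eq (d : Fin 2) (x : Fin 4) : sgnExp d x = x.val + 2 * (d.val * x.val) := by
  unfold sgnExp
  have hd : d.val < 2 := d.isLt
  by_cases h : d = 0
  · rw [if_pos h, h, Fin.val_zero]; ring
  · have h1 : d.val = 1 := by
      have : d.val ≠ 0 := fun h0 => h (Fin.ext h0)
      omega
    rw [if_neg h, h1]; ring

/-- The character value `i^{ε(δ)·x}` of the letter vector `x` at the sign pattern `δ`. [definition of this file] -/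
def chi (δ : Sgn n) (x : Letter n) : GaussianInt := I ^ (∑ k, sgnExp (δ k) (x k))

/-- The Walsh sign `(−1)^{δ·p}`. [definition of this file] -/
def wsign (δ p : Sgn n) : ℤ := if (∑ k, (δ k).val * (p k).val) % 2 = 0 then 1 else -1

/-- The weight `|x| = Σ_k x_k` (as a natural number; only `|x| mod 4` matters). [definition of this file] -/
def wt (x : Letter n) : ℕ := ∑ k, (x k).val

/-- The parity class `x mod 2 ∈ (ℤ∕2)ⁿ` of a letter vector. [definition of this file] -/
def par (x : Letter n) : Sgn n := fun k => ⟨(x k).val % 2, Nat.mod_lt _ (by norm_num)⟩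

/-- The moment `m̂(ε(δ)) = Σ_x m(x)·i^{ε·x}` of an integer-valued design `m` (t-20 §1). [definition of this file] -/
def moment (m : Letter n → ℤ) (δ : Sgn n) : GaussianInt := ∑ x, (m x : GaussianInt) * chi δ x

/-- The parity-class sums `S_p := Σ_{x ≡ p (mod 2)} m(x)·i^{|x|}` of LEMMA P. [definition of this file] -/
def S (m : Letter n → ℤ) (p : Sgn n) : GaussianInt := ∑ x, if par x = p then (m x : GaussianInt) * I ^ (wt x) else 0

/-! ## §1 The character identity and Walsh orthogonality on (ℤ∕2)ⁿ -/

/-- `Σ_k ε_k x_k ≡ |x| + 2·Σ_k δ_k x_k`. -/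
theorem sum_sgnExp (δ : Sgn n) (x : Letter n) :
    (∑ k, sgnExp (δ k) (x k)) = wt x + 2 * ∑ k, (δ k).val * (x k).val := by
  simp only [sgnExp_eq, Finset.sum_add_distrib, Finset.mul_sum, wt]

/-- FIRST SENTENCE OF LEMMA P: «for ε ∈ {±1}ⁿ, i^{ε·x} = i^{|x|}·(−1)^{Σ_{k: ε_k = −1} x_k}», for every n, δ and x. -/
theorem chi_eq (δ : Sgn n) (x : Letter n) :
    chi δ x = I ^ (wt x) * (-1) ^ (∑ k, (δ k).val * (x k).val) := by
  rw [chi, sum_sgnExp, pow_add, pow_mul, I_sq]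

/-- The Walsh sign as a power of `−1` in `ℤ[i]`. -/
theorem wsign_eq (δ p : Sgn n) :
    (wsign δ p : GaussianInt) = (-1 : GaussianInt) ^ (∑ k, (δ k).val * (p k).val) := by
  unfold wsign
  split_ifs with h
  · rw [(Nat.even_iff.mpr h).neg_one_pow]; simp
  · rw [(Nat.odd_iff.mpr (by omega)).neg_one_pow]; simp

/-- **WALSH ORTHOGONALITY ON (ℤ∕2)ⁿ (product formula):** `Σ_{δ ∈ (ℤ∕2)ⁿ} (−1)^{Σ_k δ_k q_k}` equals `2ⁿ` when every `q_k` is even and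
`0` otherwise — it is the product `Π_k (1 + (−1)^{q_k})`. -/
theorem walsh_sum (q : Fin n → ℕ) :
    (∑ δ : Sgn n, (-1 : GaussianInt) ^ (∑ k, (δ k).val * q k)) = if ∀ k, q k % 2 = 0 then 2 ^ n else 0 := by
  have h : (∑ δ : Sgn n, (-1 : GaussianInt) ^ (∑ k, (δ k).val * q k))
      = ∏ k : Fin n, ∑ d : Fin 2, (-1 : GaussianInt) ^ (d.val * q k) := by
    rw [Fintype.prod_sum]
    refine Finset.sum_congr rfl (fun δ _ => ?_)
    exact (Finset.prod_pow_eq_pow_sum _ _ _).symm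
  have hfac : ∀ k, (∑ d : Fin 2, (-1 : GaussianInt) ^ (d.val * q k)) = if q k % 2 = 0 then 2 else 0 := by
    intro k
    rw [Fin.sum_univ_two, Fin.val_zero, Fin.val_one, zero_mul, one_mul, pow_zero]
    split_ifs with hq
    · rw [(Nat.even_iff.mpr hq).neg_one_pow]; norm_num
    · rw [(Nat.odd_iff.mpr (by omega)).neg_one_pow]; norm_num
  rw [h, Finset.prod_congr rfl (fun k _ => hfac k)]
  split_ifs with hall
  · rw [Finset.prod_congr rfl (fun k _ => if_pos (hall k)), Finset.prod_const, Finset.card_univ, Fintype.card_fin]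
  · push Not at hall
    obtain ⟨k, hk⟩ := hall
    exact Finset.prod_eq_zero (Finset.mem_univ k) (if_neg hk)

/-- `x ≡ p (mod 2)` coordinatewise iff every `p_k + x_k` is even. -/
theorem par_eq_iff (x : Letter n) (p : Sgn n) : par x = p ↔ ∀ k, ((p k).val + (x k).val) % 2 = 0 := by
  constructor
  · intro h k
    have hk := congrArg Fin.val (congrFun h k)
    simp only [par] at hk
    have := (p k).isLt
    omega
  · intro h
    funext k
    apply Fin.ext
    simp only [par]
    have := h k
    have := (p k).isLt
    omega

/-- WALSH ORTHOGONALITY behind the inversion: `Σ_δ (−1)^{δ·p}·i^{ε(δ)·x} = 2ⁿ·[x ≡ p (mod 2)]·i^{|x|}` for every letter vector `x` and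
parity class `p`. -/
theorem walsh_pointwise (x : Letter n) (p : Sgn n) :
    (∑ δ : Sgn n, (wsign δ p : GaussianInt) * chi δ x) = if par x = p then 2 ^ n * I ^ (wt x) else 0 := by
  have hterm : ∀ δ : Sgn n, (wsign δ p : GaussianInt) * chi δ x
      = I ^ (wt x) * (-1 : GaussianInt) ^ (∑ k, (δ k).val * ((p k).val + (x k).val)) := by
    intro δ
    have hsum : (∑ k, (δ k).val * ((p k).val + (x k).val))
        = (∑ k, (δ k).val * (p k).val) + ∑ k, (δ k).val * (x k).val := by
      rw [← Finset.sum_add_distrib]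
      exact Finset.sum_congr rfl (fun k _ => by ring)
    rw [hsum, pow_add, chi_eq, wsign_eq]
    ring
  rw [Finset.sum_congr rfl (fun δ _ => hterm δ), ← Finset.mul_sum, walsh_sum (fun k => (p k).val + (x k).val)]
  by_cases hp : par x = p
  · rw [if_pos ((par_eq_iff x p).mp hp), if_pos hp, mul_comm]
  · rw [if_neg (fun h => hp ((par_eq_iff x p).mpr h)), if_neg hp, mul_zero]

/-! ## §2 The inversion and the formula for `S_p` -/

/-- **WALSH–HADAMARD INVERSION:** `2ⁿ·S_p = Σ_δ (−1)^{δ·p}·m̂(δ)` for every integer design `m` and every parity class `p` («the vector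
(m̂(ε))_ε is the Walsh–Hadamard transform of (S_p)_p», §2.2). -/
theorem inversion (m : Letter n → ℤ) (p : Sgn n) :
    (2 : GaussianInt) ^ n * S m p = ∑ δ : Sgn n, (wsign δ p : GaussianInt) * moment m δ := by
  calc (2 : GaussianInt) ^ n * S m p
      = ∑ x, (m x : GaussianInt) * (if par x = p then 2 ^ n * I ^ (wt x) else 0) := by
        simp only [S, Finset.mul_sum]
        refine Finset.sum_congr rfl (fun x _ => ?_)
        split_ifs <;> ring
    _ = ∑ x, (m x : GaussianInt) * ∑ δ : Sgn n, (wsign δ p : GaussianInt) * chi δ x := by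
        refine Finset.sum_congr rfl (fun x _ => ?_)
        rw [walsh_pointwise x p]
    _ = ∑ δ : Sgn n, (wsign δ p : GaussianInt) * moment m δ := by
        simp only [moment, Finset.mul_sum]
        rw [Finset.sum_comm]
        refine Finset.sum_congr rfl (fun δ _ => Finset.sum_congr rfl (fun x _ => by ring))

/-- The all-plus pattern `δ = 0` has Walsh sign `+1` at every `p`. -/
theorem wsign_zero (p : Sgn n) : wsign 0 p = 1 := by
  simp [wsign]

/-- The all-minus pattern `δ = 1` has Walsh sign `(−1)^{|p|}`. -/
theorem wsign_one (p : Sgn n) : wsign 1 p = if (∑ k, (p k).val) % 2 = 0 then 1 else -1 := by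
  simp [wsign]

/-- The all-plus character is `i^{|x|}`. -/
theorem chi_zero (x : Letter n) : chi 0 x = I ^ (wt x) := by
  simp [chi, sgnExp, wt]

/-- The all-minus character is `i^{3|x|} = conj i^{|x|}`. -/
theorem chi_one (x : Letter n) : chi 1 x = star (I ^ (wt x)) := by
  have h : chi (1 : Sgn n) x = I ^ (3 * wt x) := by
    simp only [chi, sgnExp, wt, Pi.one_apply, one_ne_zero, if_false, Finset.mul_sum]
  rw [h, pow_mul, star_pow, star_I]

/-- `m̂(−,…,−) = conj m̂(+,…,+)` for an INTEGER-valued design («m̂(−1ⁿ) = ᾱ»). -/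
theorem moment_one_eq_star (m : Letter n → ℤ) : moment m 1 = star (moment m 0) := by
  simp only [moment, star_sum, star_mul', star_intCast]
  refine Finset.sum_congr rfl (fun x _ => ?_)
  rw [chi_zero, chi_one]

/-- For `n ≥ 1` the all-plus and all-minus patterns are different. -/
theorem zero_ne_one_sgn (hn : 0 < n) : (0 : Sgn n) ≠ 1 := by
  intro h
  have := congrFun h ⟨0, hn⟩
  simp at this

/-- **THE FORMULA FOR `S_p`** (n ≥ 1): if all `2ⁿ − 2` mixed moments vanish then `2ⁿ·S_p = α + (−1)^{|p|}·ᾱ` with `α = m̂(+,…,+)`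
(«invert to S_p = 2^{−n}(α + (−1)^{|p|}ᾱ)», §2.2). -/
theorem S_formula (hn : 0 < n) (m : Letter n → ℤ) (hmixed : ∀ δ : Sgn n, δ ≠ 0 → δ ≠ 1 → moment m δ = 0) (p : Sgn n) :
    (2 : GaussianInt) ^ n * S m p = moment m 0 + (wsign 1 p : GaussianInt) * star (moment m 0) := by
  rw [inversion, ← moment_one_eq_star]
  rw [Finset.sum_eq_add_of_mem (0 : Sgn n) (1 : Sgn n) (Finset.mem_univ _) (Finset.mem_univ _) (zero_ne_one_sgn hn)]
  · simp [wsign_zero]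
  · intro δ _ hδ
    rw [hmixed δ hδ.1 hδ.2, mul_zero]

/-- Real and imaginary parts: `2ⁿ·S_p` is `2·Re α` on even classes and `2i·Im α` on odd classes («S_p = Re α/2^{n−1} for |p| even and
i·Im α/2^{n−1} for |p| odd»). -/
theorem S_formula_parts (hn : 0 < n) (m : Letter n → ℤ) (hmixed : ∀ δ : Sgn n, δ ≠ 0 → δ ≠ 1 → moment m δ = 0) (p : Sgn n) :
    (2 : GaussianInt) ^ n * S m p = if (∑ k, (p k).val) % 2 = 0 then (⟨2 * (moment m 0).re, 0⟩ : GaussianInt)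
      else (⟨0, 2 * (moment m 0).im⟩ : GaussianInt) := by
  rw [S_formula hn m hmixed p, wsign_one]
  split_ifs with h
  · ext <;> simp [two_mul]
  · ext <;> simp [two_mul]

/-- `Re α ≠ 0` ⇒ every EVEN parity class has `S_p ≠ 0`. -/
theorem S_ne_zero_of_even (hn : 0 < n) (m : Letter n → ℤ) (hmixed : ∀ δ : Sgn n, δ ≠ 0 → δ ≠ 1 → moment m δ = 0)
    (hre : (moment m 0).re ≠ 0) (p : Sgn n) (hp : (∑ k, (p k).val) % 2 = 0) : S m p ≠ 0 := by
  intro hS0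
  have h := S_formula_parts hn m hmixed p
  rw [hS0, mul_zero, if_pos hp] at h
  have := congrArg Zsqrtd.re h
  simp at this
  exact hre (by linarith)

/-- `Im α ≠ 0` ⇒ every ODD parity class has `S_p ≠ 0`. -/
theorem S_ne_zero_of_odd (hn : 0 < n) (m : Letter n → ℤ) (hmixed : ∀ δ : Sgn n, δ ≠ 0 → δ ≠ 1 → moment m δ = 0)
    (him : (moment m 0).im ≠ 0) (p : Sgn n) (hp : (∑ k, (p k).val) % 2 = 1) : S m p ≠ 0 := by
  intro hS0
  have h := S_formula_parts hn m hmixed p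
  rw [hS0, mul_zero, if_neg (by omega)] at h
  have := congrArg Zsqrtd.im h
  simp at this
  exact him (by linarith)

/-! ## §3 Counting parity classes and LEMMA P for every n -/

/-- A non-zero parity-class sum `S_p ≠ 0` forces a letter of that parity class in the support of `m`. -/
theorem exists_support_of_S_ne_zero (m : Letter n → ℤ) (p : Sgn n) (hS : S m p ≠ 0) : ∃ x, par x = p ∧ m x ≠ 0 := by
  by_contra h
  push Not at h
  apply hS
  refine Finset.sum_eq_zero (fun x _ => ?_)
  by_cases hx : par x = p
  · rw [if_pos hx, h x hx]; simp
  · rw [if_neg hx]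

/-- **EACH PARITY FAMILY OF (ℤ∕2)^{k+1} HAS 2^k CLASSES:** the patterns `p` with `|p| ≡ r (mod 2)` (`r = 0` or `1`) are in bijection
with (ℤ∕2)^k by forgetting the first coordinate (which the parity condition determines). -/
theorem card_parityFamily (k r : ℕ) (hr : r < 2) :
    (Finset.univ.filter (fun p : Sgn (k + 1) => (∑ i, (p i).val) % 2 = r)).card = 2 ^ k := by
  have hcard : (Finset.univ : Finset (Sgn k)).card = 2 ^ k := by
    rw [Finset.card_univ, Fintype.card_fun, Fintype.card_fin, Fintype.card_fin]
  rw [← hcard]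
  refine Finset.card_bij' (fun p _ => Fin.tail p)
    (fun q _ => Fin.cons ⟨(r + ∑ i, (q i).val) % 2, Nat.mod_lt _ (by norm_num)⟩ q)
    (fun p _ => Finset.mem_univ _) ?_ ?_ ?_
  · intro q _
    refine Finset.mem_filter.mpr ⟨Finset.mem_univ _, ?_⟩
    rw [Fin.sum_univ_succ]
    simp only [Fin.cons_zero, Fin.cons_succ]
    omega
  · intro p hp
    have hp' := (Finset.mem_filter.mp hp).2
    rw [Fin.sum_univ_succ] at hp'
    have h0 : (⟨(r + ∑ i, (Fin.tail p i).val) % 2, Nat.mod_lt _ (by norm_num)⟩ : Fin 2) = p 0 := by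
      apply Fin.ext
      simp only [Fin.tail]
      have := (p 0).isLt
      omega
    rw [h0]
    exact Fin.cons_self_tail p
  · intro q _
    exact Fin.tail_cons _ _

/-- **LEMMA P FOR EVERY n (t-20 §2.2; census words «LEMMA P bound 2^(n−1)»):** an INTEGER-valued design `m : (ℤ∕4)ⁿ → ℤ` (effective
or signed) whose `2ⁿ − 2` mixed-sign full moments vanish and whose moment `α = m̂(+,…,+)` is non-zero has at least `2^{n−1}` letter
vectors in its support: if `Re α ≠ 0` every EVEN parity class carries support, if `Im α ≠ 0` every ODD one does, and each family has
`2^{n−1}` classes. (At `n = 0` the bound reads `1 ≤ #support`, which `α ≠ 0` gives directly.) -/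
theorem two_pow_le_card_support (m : Letter n → ℤ) (hmixed : ∀ δ : Sgn n, δ ≠ 0 → δ ≠ 1 → moment m δ = 0)
    (halive : moment m 0 ≠ 0) : 2 ^ (n - 1) ≤ (Finset.univ.filter (fun x : Letter n => m x ≠ 0)).card := by
  cases n with
  | zero =>
    obtain ⟨x, _, hx⟩ := Finset.exists_ne_zero_of_sum_ne_zero halive
    have hmx : m x ≠ 0 := by
      intro h0
      apply hx
      rw [h0]; simp
    exact Finset.card_pos.mpr ⟨x, Finset.mem_filter.mpr ⟨Finset.mem_univ x, hmx⟩⟩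
  | succ k =>
    have hn : 0 < k + 1 := Nat.succ_pos k
    have hparts : (moment m 0).re ≠ 0 ∨ (moment m 0).im ≠ 0 := by
      by_contra h
      push Not at h
      exact halive (Zsqrtd.ext h.1 h.2)
    -- the parity family chosen by α: even classes if Re α ≠ 0, odd classes otherwise (then Im α ≠ 0)
    obtain ⟨r, hr2, hSne⟩ : ∃ r : ℕ, r < 2 ∧ ∀ p : Sgn (k + 1), (∑ i, (p i).val) % 2 = r → S m p ≠ 0 := by
      rcases hparts with h | h
      · exact ⟨0, by norm_num, fun p hp => S_ne_zero_of_even hn m hmixed h p hp⟩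
      · exact ⟨1, by norm_num, fun p hp => S_ne_zero_of_odd hn m hmixed h p hp⟩
    set F : Finset (Sgn (k + 1)) := Finset.univ.filter (fun p : Sgn (k + 1) => (∑ i, (p i).val) % 2 = r) with hF
    have hFcard : F.card = 2 ^ k := card_parityFamily k r hr2
    -- `par` maps the support onto the classes of F
    have hsub : F ⊆ (Finset.univ.filter (fun x : Letter (k + 1) => m x ≠ 0)).image par := by
      intro p hp
      obtain ⟨x, hx, hmx⟩ := exists_support_of_S_ne_zero m p (hSne p (Finset.mem_filter.mp hp).2)
      exact Finset.mem_image.mpr ⟨x, Finset.mem_filter.mpr ⟨Finset.mem_univ x, hmx⟩, hx⟩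
    calc 2 ^ (k + 1 - 1) = F.card := by rw [hFcard, Nat.add_sub_cancel]
      _ ≤ ((Finset.univ.filter (fun x : Letter (k + 1) => m x ≠ 0)).image par).card := Finset.card_le_card hsub
      _ ≤ (Finset.univ.filter (fun x : Letter (k + 1) => m x ≠ 0)).card := Finset.card_image_le

/-- COROLLARY (t-20 §2.4 (a) at n = 4, and every n): an integer design whose mixed moments vanish and whose support has FEWER THAN
`2^{n−1}` letter vectors is W-DEAD: `m̂(+,…,+) = 0`. -/
theorem moment_zero_eq_zero_of_card_lt (m : Letter n → ℤ) (hmixed : ∀ δ : Sgn n, δ ≠ 0 → δ ≠ 1 → moment m δ = 0)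
    (hlt : (Finset.univ.filter (fun x : Letter n => m x ≠ 0)).card < 2 ^ (n - 1)) : moment m 0 = 0 := by
  by_contra h
  have := two_pow_le_card_support m hmixed h
  omega

/-! ## §4 The «only if» half of the equality clause -/

/-- If BOTH `Re α ≠ 0` and `Im α ≠ 0` then EVERY one of the `2ⁿ` parity classes carries support, so the support has at least `2ⁿ`
letter vectors (the two parity families are used simultaneously; n ≥ 1). -/
theorem two_pow_le_card_support_of_re_im (hn : 0 < n) (m : Letter n → ℤ)
    (hmixed : ∀ δ : Sgn n, δ ≠ 0 → δ ≠ 1 → moment m δ = 0)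
    (hre : (moment m 0).re ≠ 0) (him : (moment m 0).im ≠ 0) :
    2 ^ n ≤ (Finset.univ.filter (fun x : Letter n => m x ≠ 0)).card := by
  have hSne : ∀ p : Sgn n, S m p ≠ 0 := by
    intro p
    by_cases hp : (∑ k, (p k).val) % 2 = 0
    · exact S_ne_zero_of_even hn m hmixed hre p hp
    · exact S_ne_zero_of_odd hn m hmixed him p (by omega)
  have hsub : (Finset.univ : Finset (Sgn n)) ⊆ (Finset.univ.filter (fun x : Letter n => m x ≠ 0)).image par := by
    intro p _
    obtain ⟨x, hx, hmx⟩ := exists_support_of_S_ne_zero m p (hSne p)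
    exact Finset.mem_image.mpr ⟨x, Finset.mem_filter.mpr ⟨Finset.mem_univ x, hmx⟩, hx⟩
  have hcard : (Finset.univ : Finset (Sgn n)).card = 2 ^ n := by
    rw [Finset.card_univ, Fintype.card_fun, Fintype.card_fin, Fintype.card_fin]
  calc 2 ^ n = (Finset.univ : Finset (Sgn n)).card := hcard.symm
    _ ≤ ((Finset.univ.filter (fun x : Letter n => m x ≠ 0)).image par).card := Finset.card_le_card hsub
    _ ≤ (Finset.univ.filter (fun x : Letter n => m x ≠ 0)).card := Finset.card_image_le

/-- **«EQUALITY IFF», ONLY-IF HALF (α real or imaginary):** a design attaining the bound — mixed moments 0, support of size EXACTLY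
`2^{n−1}`, `n ≥ 1` — has `α` REAL or PURELY IMAGINARY (one parity family only). -/
theorem re_eq_zero_or_im_eq_zero_of_card_eq (hn : 0 < n) (m : Letter n → ℤ)
    (hmixed : ∀ δ : Sgn n, δ ≠ 0 → δ ≠ 1 → moment m δ = 0)
    (hcard : (Finset.univ.filter (fun x : Letter n => m x ≠ 0)).card = 2 ^ (n - 1)) :
    (moment m 0).re = 0 ∨ (moment m 0).im = 0 := by
  by_contra h
  push Not at h
  have hle := two_pow_le_card_support_of_re_im hn m hmixed h.1 h.2
  rw [hcard] at hle
  have hlt : 2 ^ (n - 1) < 2 ^ n := Nat.pow_lt_pow_right (by norm_num) (by omega)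
  omega

end Summit.Ventures.HSemireg.WalshParityN
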